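import Summits.Schanuel.Schanuel.Theorems.SoloInformedX193Liquid
import Summits.Schanuel.Schanuel.Theorems.SoloInformedX193Numerics

/-!
# X193 kernel line, file F6c: the cheap assignment (H6) at every large level

Solo seat `solo-Schanuel-informed`, X193 kernel programme (design note
`work/s213/X193-KERNEL-DESIGN.md`, Amendment A9 (iv); pen proof `work/s194/X193-pen.md` §6;
files F6a = `SoloInformedX193Exceptional` (deep-served columns), F6b =
`SoloInformedX193Liquid` (liquid columns), F7a = `SoloInformedX193Lives` ((H6) =
`SoloServiceData.cheapAssignable`), F7d = `SoloInformedX193Numerics` (logarithmic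
tails), F7e = `SoloInformedX193Count` (the count refuting (H6))).

Pen §6 (F0) and the assembly of (H6).  At a level `n` and for `K ≤ n^σ`, an active
column `1 ≤ k ≤ K` either is LIQUID (no alive piece supplies `λ n^ν`) or has a MAIN
server `srv k` (alive, `λ n^ν ≤ m d^k`), chosen once and for all; a main column is
DEEP-SERVED if `cap_n (srv k) < d^k_{srv k}` and CAPPED otherwise.  A capped main column
`k` is EXPENSIVE if its server `P = srv k` has `η n^ν s_P < m_P C_P(n)`, where `s_P` is
the number of capped main columns served by `P`.  The exceptional set is
`Exc = liquid ∪ deep-served ∪ expensive`, and with `X = n^β n = n^{σ-γ} n^ν`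
(`ν + (σ - γ) = 1 + β`):

* `|liquid| (1-λ) n^ν ≤ (3 + 2 b₁) X` (file F6b `liquid_count`, once
  `4 c₀ n ≤ (1-λ) n^ν` and `16 A₁ n² log (n+2) ≤ n^β`);
* `|deep-served| λ n^ν ≤ (3 + b₁) X` (file F6a `deep_count`, once `c₀ n < λ n^ν` and
  `A₃ n² log (n+2) ≤ n^β`);
* `|expensive| η n^ν ≤ Σ_P m_P C_P(n) ≤ (2 + b₁) X` (fibrewise over the servers, (Bud));
* every remaining column is capped and main, and its server is cheap with its whole
  fibre of capped main columns remaining, so `m C ≤ η n^ν · #fibre`.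

This is (H6) with `A₆ = (3 + 2 b₁)/(1-λ) + (3 + b₁)/λ + (2 + b₁)/η`, from the level
where the four eventual inequalities hold (`soloX_assign_eventually`, from file F7d's
tails).  Main theorem: `SoloServiceData.cheapAssignable_of_laws`.  After this file the
hypotheses of the count (file F7e) are (WF), (Bud), (Srv), (PAIR), (L1) and the two
families `noCheapDepth` (file F4) and `deepUnique` (file F3).  No sorries.
-/

namespace Summit.Schanuel.Schanuel.Theorems

open Finset Filter

/-! ### Arithmetic of the absorptions -/

/-- Cancellation: `a (c Y) ≤ M (X Y)` with `c, Y > 0` gives `a ≤ (M / c) X`. -/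
theorem soloX_le_div_mul_of_mul_le {a c M X Y : ℝ} (hc : 0 < c) (hY : 0 < Y)
    (h : a * (c * Y) ≤ M * (X * Y)) : a ≤ M / c * X := by
  have h' : a * c * Y ≤ M * X * Y := by
    calc a * c * Y = a * (c * Y) := by ring
      _ ≤ M * (X * Y) := h
      _ = M * X * Y := by ring
  rw [div_mul_eq_mul_div, le_div_iff₀ hc]
  exact le_of_mul_le_mul_right h' hY

/-- The four eventual inequalities of a large level used by the assignment:
`c₀ n < λ n^ν` and `4 c₀ n ≤ (1-λ) n^ν` (`ν > 1`), `16 A₁ n² log (n+2) ≤ n^β` and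
`A₃ n² log (n+2) ≤ n^β` (`β > 2`, file F7d `soloX_hbig_tail`). -/
theorem soloX_assign_eventually {c₀ lam ν β A₁ A₃ : ℝ} (hlam : 0 < lam)
    (hlam1 : lam < 1) (hν : 1 < ν) (hβ : 2 < β) (hA₁ : 0 ≤ A₁) (hA₃ : 0 ≤ A₃) :
    ∀ᶠ n : ℕ in atTop,
      c₀ * n < lam * (n : ℝ) ^ ν ∧ 4 * c₀ * n ≤ (1 - lam) * (n : ℝ) ^ ν ∧
      16 * A₁ * (n : ℝ) ^ 2 * Real.log ((n : ℝ) + 2) ≤ (n : ℝ) ^ β ∧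
      A₃ * (n : ℝ) ^ 2 * Real.log ((n : ℝ) + 2) ≤ (n : ℝ) ^ β := by
  have h16 : (0 : ℝ) ≤ 16 * A₁ := by positivity
  have h4 : (0 : ℝ) < 4 := by norm_num
  filter_upwards [eventually_const_mul_rpow_le_rpow hν ((c₀ + 1) / lam),
    eventually_const_mul_rpow_le_rpow hν (4 * c₀ / (1 - lam)),
    soloX_hbig_tail h16 h4 hβ, soloX_hbig_tail hA₃ h4 hβ, eventually_ge_atTop 1]
    with n h1 h2 h3 h4' hn
  have hn0 : (0 : ℝ) < n := by exact_mod_cast hn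
  rw [Real.rpow_one] at h1 h2
  have i1 := mul_le_mul_of_nonneg_left h1 hlam.le
  have i2 := mul_le_mul_of_nonneg_left h2 (by linarith : (0 : ℝ) ≤ 1 - lam)
  have e1 : lam * ((c₀ + 1) / lam * n) = c₀ * n + n := by
    rw [show lam * ((c₀ + 1) / lam * n) = lam / lam * (c₀ * n + n) by ring,
      div_self hlam.ne', one_mul]
  have e2 : (1 - lam) * (4 * c₀ / (1 - lam) * n) = 4 * c₀ * n := by
    rw [show (1 - lam) * (4 * c₀ / (1 - lam) * n) = (1 - lam) / (1 - lam) * (4 * c₀ * n)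
      by ring, div_self (by linarith : (1 - lam) ≠ 0), one_mul]
  rw [e1] at i1
  rw [e2] at i2
  have e3 : (4 : ℝ) / 4 * (n : ℝ) ^ β = (n : ℝ) ^ β := by norm_num
  exact ⟨by linarith, i2, by linarith, by linarith⟩

namespace SoloServiceData

variable {ι : Type*} (D : SoloServiceData ι)

/-! ### (H6) from the laws -/

/-- (H6) FROM THE LAWS (pen §6): under (WF), (Bud), (Srv), (PAIR), no-cheap-depth (file F4)
and deep-column uniqueness (file F3), for `β > 2`, `ν > 1`, `ν + (σ-γ) = 1 + β`,
`0 ≤ σ ≤ 1`, `0 < λ < 1`, `η > 0`, every large level admits a cheap capped main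
assignment of all but `A₆ n^{σ-γ}` of the columns `1 ≤ k ≤ K ≤ n^σ`, where
`A₆ = (3 + 2 b₁)/(1-λ) + (3 + b₁)/λ + (2 + b₁)/η`: `D ∈ cheapAssignable …`. -/
theorem cheapAssignable_of_laws [DecidableEq ι] {c₀ β b₁ σ ν γ lam η A₁ A₃ B : ℝ}
    {n₀ n₃ n₄ : ℕ} (hW : D ∈ wellFormed c₀) (hc₀ : 0 ≤ c₀) (hB : D ∈ budgetLaw β b₁ n₀)
    (hS : D ∈ serviceLaw σ ν c₀ n₀) (hP : D ∈ pairLaw A₁)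
    (hN : D ∈ noCheapDepth σ ν β A₃ n₃) (hU : D ∈ deepUnique σ B n₄)
    (hβ : 2 < β) (hν : 1 < ν) (hνβ : ν + (σ - γ) = 1 + β) (hσ : 0 ≤ σ) (hσ1 : σ ≤ 1)
    (hlam : 0 < lam) (hlam1 : lam < 1) (hη : 0 < η) (hb₁ : 0 ≤ b₁) (hA₁ : 0 ≤ A₁)
    (hA₃ : 0 ≤ A₃) :
    ∃ n₆ : ℕ, D ∈ cheapAssignable lam η σ γ ν β B
      ((3 + 2 * b₁) / (1 - lam) + (3 + b₁) / lam + (2 + b₁) / η) n₆ := by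
  classical
  obtain ⟨N, hNth⟩ := Filter.eventually_atTop.mp
    (soloX_assign_eventually (c₀ := c₀) hlam hlam1 hν hβ hA₁ hA₃)
  refine ⟨max N (max n₀ (max n₃ (max n₄ 1))), fun n hn K hK => ?_⟩
  obtain ⟨hnN, hn₀, hn₃, hn₄, hn1⟩ : N ≤ n ∧ n₀ ≤ n ∧ n₃ ≤ n ∧ n₄ ≤ n ∧ 1 ≤ n := by
    simpa only [max_le_iff] using hn
  obtain ⟨hT1, hT2, hT3, hT4⟩ := hNth n hnN
  have hn0 : (0 : ℝ) < n := by exact_mod_cast hn1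
  have hn1' : (1 : ℝ) ≤ n := by exact_mod_cast hn1
  have hνpos : 0 < (n : ℝ) ^ ν := Real.rpow_pos_of_pos hn0 ν
  have hην : 0 ≤ η * (n : ℝ) ^ ν := mul_nonneg hη.le hνpos.le
  have hc₀n : 0 ≤ c₀ * n := mul_nonneg hc₀ hn0.le
  have hpos : 2 * c₀ * n < (n : ℝ) ^ ν := by linarith
  -- `K ≤ n`, `log (K+2) ≤ log (n+2)`, `n² ≤ n^β n = X`, `n^{σ-γ} n^ν = X`
  have hKn : (K : ℝ) ≤ n := hK.trans (by
    calc (n : ℝ) ^ σ ≤ (n : ℝ) ^ (1 : ℝ) := Real.rpow_le_rpow_of_exponent_le hn1' hσ1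
      _ = n := Real.rpow_one _)
  have hlogK : Real.log ((K : ℝ) + 2) ≤ Real.log ((n : ℝ) + 2) :=
    Real.log_le_log (by positivity) (by linarith)
  have hsq : (n : ℝ) ^ 2 ≤ (n : ℝ) ^ β * n := by
    have h1 : (n : ℝ) ≤ (n : ℝ) ^ β := by
      calc (n : ℝ) = (n : ℝ) ^ (1 : ℝ) := (Real.rpow_one _).symm
        _ ≤ (n : ℝ) ^ β := Real.rpow_le_rpow_of_exponent_le hn1' (by linarith)
    rw [pow_two]
    exact mul_le_mul_of_nonneg_right h1 hn0.le
  have hb₁sq : b₁ * (n : ℝ) ^ 2 ≤ b₁ * ((n : ℝ) ^ β * n) := mul_le_mul_of_nonneg_left hsq hb₁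
  have hX : (n : ℝ) ^ (σ - γ) * (n : ℝ) ^ ν = (n : ℝ) ^ β * n := by
    rw [← Real.rpow_add hn0, show σ - γ + ν = β + 1 by linarith, Real.rpow_add hn0,
      Real.rpow_one]
  -- an alive piece exists (column `1` is active and served)
  have hne : (D.alive n).Nonempty := by
    rw [Finset.nonempty_iff_ne_empty]
    intro h
    have h1 := hS n hn₀ 1 le_rfl (by rw [Nat.cast_one]; exact Real.one_le_rpow hn1' hσ)
    rw [h, Finset.sum_empty] at h1
    linarith
  obtain ⟨P₀, hP₀⟩ := hne
  -- main servers, chosen once per column (default `P₀` on liquid columns)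
  have hch : ∀ k : ℕ, ∃ P : ι,
      (∃ Q ∈ D.alive n, lam * (n : ℝ) ^ ν ≤ D.mult Q n * D.bank Q k) →
        P ∈ D.alive n ∧ lam * (n : ℝ) ^ ν ≤ D.mult P n * D.bank P k := by
    intro k
    by_cases h : ∃ Q ∈ D.alive n, lam * (n : ℝ) ^ ν ≤ D.mult Q n * D.bank Q k
    · obtain ⟨Q, hQ, hQ'⟩ := h
      exact ⟨Q, fun _ => ⟨hQ, hQ'⟩⟩
    · exact ⟨P₀, fun h' => absurd h' h⟩
  choose srv hsrv using hch
  have hmain : ∀ k : ℕ,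
      ¬ (∀ P ∈ D.alive n, (D.mult P n : ℝ) * D.bank P k < lam * (n : ℝ) ^ ν) →
        srv k ∈ D.alive n ∧ lam * (n : ℝ) ^ ν ≤ D.mult (srv k) n * D.bank (srv k) k := by
    intro k hk
    refine hsrv k ?_
    by_contra h
    exact hk fun P hP => not_le.mp fun h' => h ⟨P, hP, h'⟩
  -- liquid, deep-served, capped (`Rs`) and expensive columns
  obtain ⟨Lq, hLq⟩ : ∃ Lq : Finset ℕ, ∀ k, k ∈ Lq ↔ k ∈ Finset.Icc 1 K ∧
      ∀ P ∈ D.alive n, (D.mult P n : ℝ) * D.bank P k < lam * (n : ℝ) ^ ν :=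
    ⟨(Finset.Icc 1 K).filter (fun k =>
        ∀ P ∈ D.alive n, (D.mult P n : ℝ) * D.bank P k < lam * (n : ℝ) ^ ν),
      fun k => Finset.mem_filter⟩
  obtain ⟨Dp, hDp⟩ : ∃ Dp : Finset ℕ, ∀ k, k ∈ Dp ↔ k ∈ Finset.Icc 1 K ∧
      (¬ (∀ P ∈ D.alive n, (D.mult P n : ℝ) * D.bank P k < lam * (n : ℝ) ^ ν) ∧
        D.cap B (srv k) n < D.bank (srv k) k) :=
    ⟨(Finset.Icc 1 K).filter (fun k =>
        ¬ (∀ P ∈ D.alive n, (D.mult P n : ℝ) * D.bank P k < lam * (n : ℝ) ^ ν) ∧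
          D.cap B (srv k) n < D.bank (srv k) k),
      fun k => Finset.mem_filter⟩
  obtain ⟨Rs, hRs⟩ : ∃ Rs : Finset ℕ, ∀ k, k ∈ Rs ↔ k ∈ Finset.Icc 1 K ∧
      (¬ (∀ P ∈ D.alive n, (D.mult P n : ℝ) * D.bank P k < lam * (n : ℝ) ^ ν) ∧
        D.bank (srv k) k ≤ D.cap B (srv k) n) :=
    ⟨(Finset.Icc 1 K).filter (fun k =>
        ¬ (∀ P ∈ D.alive n, (D.mult P n : ℝ) * D.bank P k < lam * (n : ℝ) ^ ν) ∧
          D.bank (srv k) k ≤ D.cap B (srv k) n),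
      fun k => Finset.mem_filter⟩
  obtain ⟨Ex, hEx⟩ : ∃ Ex : Finset ℕ, ∀ k, k ∈ Ex ↔ k ∈ Rs ∧
      η * (n : ℝ) ^ ν * ((Rs.filter (fun k' => srv k' = srv k)).card : ℝ) <
        (D.mult (srv k) n : ℝ) * D.cost β (srv k) n :=
    ⟨Rs.filter (fun k =>
        η * (n : ℝ) ^ ν * ((Rs.filter (fun k' => srv k' = srv k)).card : ℝ) <
          (D.mult (srv k) n : ℝ) * D.cost β (srv k) n),
      fun k => Finset.mem_filter⟩
  have hLqI : Lq ⊆ Finset.Icc 1 K := fun k hk => ((hLq k).mp hk).1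
  have hDpI : Dp ⊆ Finset.Icc 1 K := fun k hk => ((hDp k).mp hk).1
  have hRsA : ∀ k ∈ Rs, srv k ∈ D.alive n := fun k hk => (hmain k ((hRs k).mp hk).2.1).1
  have hExR : Ex ⊆ Rs := fun k hk => ((hEx k).mp hk).1
  -- (F1) the liquid columns
  have hL := D.liquid_count hW hc₀ hB hS hP hA₁ hn₀ hpos hK Lq hLqI
    (fun k hk => ((hLq k).mp hk).2)
  have hL' : (Lq.card : ℝ) * ((1 - lam) * (n : ℝ) ^ ν) ≤
      (3 + 2 * b₁) * ((n : ℝ) ^ (σ - γ) * (n : ℝ) ^ ν) := by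
    rw [hX]
    have h1 : (Lq.card : ℝ) * ((1 - lam) * (n : ℝ) ^ ν) ≤
        (Lq.card : ℝ) * (2 * ((1 - lam) * (n : ℝ) ^ ν - 2 * c₀ * n)) :=
      mul_le_mul_of_nonneg_left (by linarith) (Nat.cast_nonneg _)
    have h2 : 16 * A₁ * (n : ℝ) ^ 3 * Real.log ((K : ℝ) + 2) ≤ (n : ℝ) ^ β * n := by
      calc 16 * A₁ * (n : ℝ) ^ 3 * Real.log ((K : ℝ) + 2)
          ≤ 16 * A₁ * (n : ℝ) ^ 3 * Real.log ((n : ℝ) + 2) :=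
            mul_le_mul_of_nonneg_left hlogK (by positivity)
        _ = 16 * A₁ * (n : ℝ) ^ 2 * Real.log ((n : ℝ) + 2) * n := by ring
        _ ≤ (n : ℝ) ^ β * n := mul_le_mul_of_nonneg_right hT3 hn0.le
    linarith
  have hLq_le : (Lq.card : ℝ) ≤ (3 + 2 * b₁) / (1 - lam) * (n : ℝ) ^ (σ - γ) :=
    soloX_le_div_mul_of_mul_le (by linarith) hνpos hL'
  -- (T) the deep-served columns
  have hD := D.deep_count hW hc₀ hB hN hU hA₃ hlam1.le hn₀ hn₃ hn₄ hT1 hK Dp hDpI srv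
    (fun k hk => by
      obtain ⟨-, hk1, hk2⟩ := (hDp k).mp hk
      obtain ⟨ha, hm⟩ := hmain k hk1
      exact ⟨ha, hm, hk2⟩)
  have hD' : (Dp.card : ℝ) * (lam * (n : ℝ) ^ ν) ≤
      (3 + b₁) * ((n : ℝ) ^ (σ - γ) * (n : ℝ) ^ ν) := by
    rw [hX]
    have h2 : A₃ * (n : ℝ) ^ 2 * Real.log ((n : ℝ) + 2) * n ≤ (n : ℝ) ^ β * n :=
      mul_le_mul_of_nonneg_right hT4 hn0.le
    linarith
  have hDp_le : (Dp.card : ℝ) ≤ (3 + b₁) / lam * (n : ℝ) ^ (σ - γ) :=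
    soloX_le_div_mul_of_mul_le hlam hνpos hD'
  -- (F0) the expensive columns, fibrewise over their servers
  have hcost0 : ∀ P, 0 ≤ (D.mult P n : ℝ) * D.cost β P n := fun P =>
    mul_nonneg (Nat.cast_nonneg _)
      (le_trans (Real.rpow_nonneg hn0.le β) (D.rpow_le_cost hW β P n))
  have hE : (Ex.card : ℝ) * (η * (n : ℝ) ^ ν) ≤
      2 * ((n : ℝ) ^ β * n) + b₁ * (n : ℝ) ^ 2 := by
    have hfib : Ex.card = ∑ P ∈ D.alive n, (Ex.filter (fun k => srv k = P)).card :=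
      Finset.card_eq_sum_card_fiberwise
        (fun k hk => Finset.mem_coe.mpr (hRsA k (hExR (Finset.mem_coe.mp hk))))
    have hterm : ∀ P ∈ D.alive n,
        ((Ex.filter (fun k => srv k = P)).card : ℝ) * (η * (n : ℝ) ^ ν) ≤
          (D.mult P n : ℝ) * D.cost β P n := by
      intro P _
      by_cases hex : ∃ k ∈ Ex, srv k = P
      · obtain ⟨k, hk, hkP⟩ := hex
        obtain ⟨-, hlt⟩ := (hEx k).mp hk
        rw [hkP] at hlt
        have hsub : Ex.filter (fun k => srv k = P) ⊆ Rs.filter (fun k => srv k = P) :=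
          Finset.filter_subset_filter _ hExR
        have hc : ((Ex.filter (fun k => srv k = P)).card : ℝ) ≤
            (Rs.filter (fun k => srv k = P)).card := by
          exact_mod_cast Finset.card_le_card hsub
        have hc' := mul_le_mul_of_nonneg_right hc hην
        linarith
      · have h0 : Ex.filter (fun k => srv k = P) = ∅ :=
          Finset.filter_eq_empty_iff.mpr fun k hk hkP => hex ⟨k, hk, hkP⟩
        rw [h0, Finset.card_empty, Nat.cast_zero, zero_mul]
        exact hcost0 P
    calc (Ex.card : ℝ) * (η * (n : ℝ) ^ ν)
        = ∑ P ∈ D.alive n, ((Ex.filter (fun k => srv k = P)).card : ℝ) * (η * (n : ℝ) ^ ν) := by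
          rw [hfib, Nat.cast_sum, Finset.sum_mul]
      _ ≤ ∑ P ∈ D.alive n, (D.mult P n : ℝ) * D.cost β P n := Finset.sum_le_sum hterm
      _ ≤ 2 * ((n : ℝ) ^ β * n) + b₁ * (n : ℝ) ^ 2 := D.sum_mult_cost_le hB hn₀
  have hEx_le : (Ex.card : ℝ) ≤ (2 + b₁) / η * (n : ℝ) ^ (σ - γ) := by
    refine soloX_le_div_mul_of_mul_le hη hνpos ?_
    rw [hX]
    linarith
  -- the assignment
  refine ⟨Lq ∪ Dp ∪ Ex, srv, ?_, ?_⟩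
  · have hcard : ((Lq ∪ Dp ∪ Ex).card : ℝ) ≤ Lq.card + Dp.card + Ex.card := by
      exact_mod_cast (Finset.card_union_le _ _).trans
        (Nat.add_le_add_right (Finset.card_union_le _ _) _)
    have hsplit : ((3 + 2 * b₁) / (1 - lam) + (3 + b₁) / lam + (2 + b₁) / η) *
        (n : ℝ) ^ (σ - γ) =
        (3 + 2 * b₁) / (1 - lam) * (n : ℝ) ^ (σ - γ) + (3 + b₁) / lam * (n : ℝ) ^ (σ - γ) +
          (2 + b₁) / η * (n : ℝ) ^ (σ - γ) := by ring
    linarith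
  · intro k hk
    obtain ⟨hkG, hkE⟩ := Finset.mem_sdiff.mp hk
    simp only [Finset.mem_union, not_or] at hkE
    obtain ⟨⟨hkL, hkD⟩, hkX⟩ := hkE
    have hnl : ¬ (∀ P ∈ D.alive n, (D.mult P n : ℝ) * D.bank P k < lam * (n : ℝ) ^ ν) :=
      fun h => hkL ((hLq k).mpr ⟨hkG, h⟩)
    obtain ⟨hka, hkm⟩ := hmain k hnl
    have hcap : D.bank (srv k) k ≤ D.cap B (srv k) n :=
      not_lt.mp fun h => hkD ((hDp k).mpr ⟨hkG, hnl, h⟩)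
    have hkR : k ∈ Rs := (hRs k).mpr ⟨hkG, hnl, hcap⟩
    have hcheap : (D.mult (srv k) n : ℝ) * D.cost β (srv k) n ≤
        η * (n : ℝ) ^ ν * ((Rs.filter (fun k' => srv k' = srv k)).card : ℝ) :=
      not_lt.mp fun h => hkX ((hEx k).mpr ⟨hkR, h⟩)
    have hfib : Rs.filter (fun k' => srv k' = srv k) ⊆
        (Finset.Icc 1 K \ (Lq ∪ Dp ∪ Ex)).filter (fun k' => srv k' = srv k) := by
      intro k' hk'
      obtain ⟨hk'R, heq⟩ := Finset.mem_filter.mp hk'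
      obtain ⟨hk'G, hk'nl, hk'cap⟩ := (hRs k').mp hk'R
      refine Finset.mem_filter.mpr ⟨Finset.mem_sdiff.mpr ⟨hk'G, ?_⟩, heq⟩
      simp only [Finset.mem_union, not_or]
      refine ⟨⟨fun h => hk'nl ((hLq k').mp h).2, fun h => ?_⟩, fun h => ?_⟩
      · exact absurd ((hDp k').mp h).2.2 (not_lt.mpr hk'cap)
      · have hlt := ((hEx k').mp h).2
        rw [heq] at hlt
        exact absurd hlt (not_lt.mpr hcheap)
    have hcardle : ((Rs.filter (fun k' => srv k' = srv k)).card : ℝ) ≤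
        ((Finset.Icc 1 K \ (Lq ∪ Dp ∪ Ex)).filter (fun k' => srv k' = srv k)).card := by
      exact_mod_cast Finset.card_le_card hfib
    exact ⟨hka, hkm, hcap, hcheap.trans (mul_le_mul_of_nonneg_left hcardle hην)⟩

end SoloServiceData

end Summit.Schanuel.Schanuel.Theorems
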